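import Summits.QuantumAdvantage.AdviceFreeQNC0.OneSidedWindow
import Summits.QuantumAdvantage.AdviceFreeQNC0.LowDegreeGapStrategies
import HarnessLib

/-!
# Cell qa-qnc0 (rung F-Q1, route RingFrame, crux α `RingToElim`): the THREE-OFFSET LEMMA and
# TWO BLIND SPOTS in square-root form (planner qa-qnc0-p1's Sketch11 §23.3 and §23.1, VERBATIM)

Continuation of `OneSidedWindow.lean` (`oneSidedFibre`: on a window `x ++ h ++ z` whose
`z`-interior cuts do not read `x`, `WIN(x, z) = e_x(z) ⊕ B_{2|x|}(z)` with `e_x` an elimination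
win pattern of degree `D` and `B` an even `3`-periodic triple).

* `threeOffsetLemma : ThreeOffsetLemma` (Sketch11 §23.3, verbatim) — rows `x ↦ e_x ∈` the
  elimination win code, an even periodic triple `B`, an offset map `s` each of whose three
  residue fibres holds at least a quarter of the rows: the matrix `e_x(z) ⊕ B_{s(x)}(z)` has at
  least `2^L·distFail_D(0)/4` zeros.  (Row `x` has `hdist(B_{s x}, ¬e_x) ≥ distFail_D(B_{s x})`
  zeros; the three offsets give `Σ_r distFail(B_r) ≥ distFail(B_0 ⊕ B_1 ⊕ B_2) = distFail(0)` by
  the potential-cost lemma `potential_cost`.)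
* `four_mul_card_class_ge_two` — every residue class of `{0,1}^L`, `L ≥ 2`, has `≥ 2^L/4` points.
* `twoBlindSpotsSqrt : TwoBlindSpotsSqrt` (Sketch11 §23.1, verbatim) — **TWO BLIND SPOTS,
  square-root form**: there are `θ < 1`, `c₁ > 0`, `n₀` such that a walk strategy of degree
  `≤ D ≤ c₁√M` on `p + (L + H + M) + q` bits (`L ≥ 2`, `M ≥ n₀`) whose cuts strictly inside the
  `z`-block of the window `x ++ h ++ z` do not read `x` wins on at most `θ·2ⁿ` inputs, every
  charge (`θ = 1 − η₀/4`; elimination hardness `elimSqrtDec_of_lowDegAvoidMod3Sparse` gives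
  `distFail_D(0) ≥ η₀·2^M`).

This is the planner's density-`1/4` route; the flip-orbit route to the same theorem (and the
`a ++ z ++ b` / `Fin n` / polylog forms) is prover qa-qnc0-prover gen 6's `TwoBlindSpots*.lean`.
The cell's theorems (planner qa-qnc0-p1 gen 11, statements; prover qn-prover-3 gen 4, proofs),
2026-08-27; not in print.  WHAT THIS IS NOT: nothing on totally sighted strategies (α proper);
`η₀` is tiny; no separation.

## References

* S. Srinivasan, *A robust version of Hegedűs's lemma, with applications*, TheoretiCS 2 (2023),
  Lemma 3.1 [Srinivasan2023] (through `lowDegAvoidMod3Sparse`).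
-/

noncomputable section

namespace Summit.QuantumAdvantage.AdviceFreeQNC0

open Finset
open Literature.Computability.MetaComplexity Literature.Computability.MetaComplexity.Smolensky

/-! ### Sketch11 §23.3: the three-offset lemma -/

/-- **THREE-OFFSET LEMMA** (planner qa-qnc0-p1, `Sketch11` §23.3, verbatim).  Rows `x ↦ e x ∈`
elimination-win code of degree `D`, a fixed even `3`-periodic triple `B`, an offset map `s` whose
three fibres each hold at least a quarter of the rows: the matrix `(x,z) ↦ e x z ⊕ B (s x) z` has
at least `(1/4)·2^L·distFail D 0` zeros. -/
def ThreeOffsetLemma : Prop :=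
  ∀ (L M D : ℕ) (B : ℕ → (Fin M → Bool) → Bool),
    (∀ s z, B (s + 3) z = B s z) →
    (∀ s z, xor (B s z) (xor (B (s + 1) z) (B (s + 2) z)) = false) →
    ∀ s : (Fin L → Bool) → ℕ,
      (∀ r : ℕ, 2 ^ L ≤ 4 * (univ.filter fun x : Fin L → Bool => s x % 3 = r % 3).card) →
      ∀ e : (Fin L → Bool) → (Fin M → Bool) → Bool, (∀ x, IsElimWin D (e x)) →
        2 ^ L * distFail D (fun _ : Fin M → Bool => false) ≤
          4 * (univ.filter fun xz : (Fin L → Bool) × (Fin M → Bool) =>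
            xor (e xz.1 xz.2) (B (s xz.1) xz.2) = false).card

/-- **`ThreeOffsetLemma` holds.** -/
theorem threeOffsetLemma : ThreeOffsetLemma := by
  classical
  intro L M D B hper heven s hdens e he
  -- `B` depends on the offset only mod `3`
  have hmod : ∀ s z, B s z = B (s % 3) z := by
    intro s z
    have key : ∀ k r, B (r + 3 * k) z = B r z := by
      intro k
      induction k with
      | zero => intro r; simp
      | succ k ih => intro r; rw [show r + 3 * (k + 1) = (r + 3 * k) + 3 by ring, hper, ih]
    conv_lhs => rw [← Nat.mod_add_div s 3]
    exact key (s / 3) (s % 3)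
  -- each row has at least `distFail D (B_{s x})` zeros
  have hrow : ∀ x, distFail D (B (s x % 3)) ≤
      (univ.filter fun z : Fin M → Bool => xor (e x z) (B (s x) z) = false).card := by
    intro x
    obtain ⟨c₀, a, b, ha, hb, hex⟩ := he x
    have hF : IsElimFail D (elimFail c₀ a b) := ⟨c₀, a, b, ha, hb, fun _ => rfl⟩
    refine le_trans (distFail_le (B (s x % 3)) hF) (le_of_eq ?_)
    unfold hdist
    refine congrArg Finset.card (Finset.filter_congr fun z _ => ?_)
    rw [← hmod, hex z]
    cases B (s x) z <;> cases elimFail c₀ a b z <;> decide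
  -- the zeros, row by row
  have hpair : (univ.filter fun xz : (Fin L → Bool) × (Fin M → Bool) =>
      xor (e xz.1 xz.2) (B (s xz.1) xz.2) = false).card =
      ∑ x : Fin L → Bool, (univ.filter fun z : Fin M → Bool => xor (e x z) (B (s x) z) = false).card := by
    rw [Finset.card_filter, ← Finset.univ_product_univ, Finset.sum_product]
    refine Finset.sum_congr rfl fun x _ => ?_
    rw [Finset.card_filter]
  -- regroup the rows by residue of the offset
  have hd : ∀ r, r < 3 →
      2 ^ L ≤ 4 * (univ.filter fun x : Fin L → Bool => s x % 3 = r).card := by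
    intro r hr
    have h := hdens r
    rwa [Nat.mod_eq_of_lt hr] at h
  have hregroup : ∑ x : Fin L → Bool, distFail D (B (s x % 3)) =
      ∑ r ∈ range 3, (univ.filter fun x : Fin L → Bool => s x % 3 = r).card * distFail D (B r) := by
    have h1 : ∀ x : Fin L → Bool, distFail D (B (s x % 3)) =
        ∑ r ∈ range 3, (if s x % 3 = r then distFail D (B r) else 0) := by
      intro x
      rw [Finset.sum_ite_eq (range 3) (s x % 3) (fun r => distFail D (B r)),
        if_pos (Finset.mem_range.2 (Nat.mod_lt _ (by norm_num)))]
    rw [Finset.sum_congr rfl fun x _ => h1 x, Finset.sum_comm]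
    refine Finset.sum_congr rfl fun r _ => ?_
    rw [Finset.card_filter, Finset.sum_mul]
    refine Finset.sum_congr rfl fun x _ => ?_
    by_cases hx : s x % 3 = r <;> simp [hx]
  -- the three offsets
  have hpc : distFail D (fun _ : Fin M → Bool => false) ≤
      distFail D (B 0) + distFail D (B 1) + distFail D (B 2) := by
    refine potential_cost D (B 0) (B 1) (B 2) fun z => ?_
    have h := heven 0 z
    rw [Nat.zero_add, Nat.zero_add] at h
    rw [Bool.xor_assoc]
    exact h
  have hsum3 : ∑ r ∈ range 3, (univ.filter fun x : Fin L → Bool => s x % 3 = r).card * distFail D (B r)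
      = (univ.filter fun x : Fin L → Bool => s x % 3 = 0).card * distFail D (B 0)
        + (univ.filter fun x : Fin L → Bool => s x % 3 = 1).card * distFail D (B 1)
        + (univ.filter fun x : Fin L → Bool => s x % 3 = 2).card * distFail D (B 2) := by
    simp only [Finset.sum_range_succ, Finset.sum_range_zero, zero_add]
  have h0 := hd 0 (by norm_num)
  have h1 := hd 1 (by norm_num)
  have h2 := hd 2 (by norm_num)
  have hrows : ∑ x : Fin L → Bool, distFail D (B (s x % 3)) ≤
      ∑ x : Fin L → Bool, (univ.filter fun z : Fin M → Bool => xor (e x z) (B (s x) z) = false).card :=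
    Finset.sum_le_sum fun x _ => hrow x
  rw [hpair]
  rw [hregroup, hsum3] at hrows
  calc 2 ^ L * distFail D (fun _ : Fin M → Bool => false)
      ≤ 2 ^ L * (distFail D (B 0) + distFail D (B 1) + distFail D (B 2)) :=
        Nat.mul_le_mul_left _ hpc
    _ = 2 ^ L * distFail D (B 0) + 2 ^ L * distFail D (B 1) + 2 ^ L * distFail D (B 2) := by ring
    _ ≤ 4 * (univ.filter fun x : Fin L → Bool => s x % 3 = 0).card * distFail D (B 0)
        + 4 * (univ.filter fun x : Fin L → Bool => s x % 3 = 1).card * distFail D (B 1)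
        + 4 * (univ.filter fun x : Fin L → Bool => s x % 3 = 2).card * distFail D (B 2) :=
        add_le_add (add_le_add (Nat.mul_le_mul_right _ h0) (Nat.mul_le_mul_right _ h1))
          (Nat.mul_le_mul_right _ h2)
    _ = 4 * ((univ.filter fun x : Fin L → Bool => s x % 3 = 0).card * distFail D (B 0)
        + (univ.filter fun x : Fin L → Bool => s x % 3 = 1).card * distFail D (B 1)
        + (univ.filter fun x : Fin L → Bool => s x % 3 = 2).card * distFail D (B 2)) := by ring
    _ ≤ 4 * ∑ x : Fin L → Bool,
          (univ.filter fun z : Fin M → Bool => xor (e x z) (B (s x) z) = false).card :=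
        Nat.mul_le_mul_left _ hrows

/-! ### Residue classes of a block of at least two bits -/

/-- Every residue class of `{0,1}^L`, `L ≥ 2`, has at least `2^L / 4` elements (`L ≥ 3`:
`four_mul_card_class_ge`; `L = 2`: the classes have `1, 2, 1` elements). -/
theorem four_mul_card_class_ge_two {L : ℕ} (hL : 2 ≤ L) (r : ℕ) :
    2 ^ L ≤ 4 * (univ.filter fun x : Fin L → Bool => wt x % 3 = r % 3).card := by
  rcases Nat.lt_or_ge L 3 with h3 | h3
  · have hL2 : L = 2 := by omega
    subst hL2
    have h := three_mul_card_class_add_two_ge 2 r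
    have h4 : (2 : ℕ) ^ 2 = 4 := by norm_num
    rw [h4] at h ⊢
    omega
  · exact four_mul_card_class_ge h3 r

/-! ### Sketch11 §23.1: two blind spots, square-root form -/

/-- **T8, √-form** (planner qa-qnc0-p1, `Sketch11` §23.1, verbatim): window
`a(p) ++ x(L) ++ h(H) ++ z(M) ++ b(q)`; the cuts strictly inside `z` do not read `x`. -/
def TwoBlindSpotsSqrt : Prop :=
  ∃ θ : ℝ, θ < 1 ∧ ∃ c₁ : ℝ, 0 < c₁ ∧ ∃ n₀ : ℕ, ∀ p L H M q : ℕ, 2 ≤ L → n₀ ≤ M →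
    ∀ D : ℕ, (D : ℝ) ≤ c₁ * Real.sqrt M →
    ∀ (c : ℕ) (y : Fin (p + (L + H + M) + q + 1) → (Fin (p + (L + H + M) + q) → Bool) → Bool),
      (∀ g, HasDeg (y g) D) →
      (∀ g : Fin (p + (L + H + M) + q + 1), p + (L + H) < g.val → g.val < p + (L + H + M) →
        ∀ (a : Fin p → Bool) (x x' : Fin L → Bool) (h : Fin H → Bool) (z : Fin M → Bool)
          (b : Fin q → Bool), y g (glue3 a (glue3 x h z) b) = y g (glue3 a (glue3 x' h z) b)) →
      ((univ.filter fun u : Fin (p + (L + H + M) + q) → Bool => ringWinU c y u = true).card : ℝ) ≤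
        θ * (2 : ℝ) ^ (p + (L + H + M) + q)

variable {L H M : ℕ}

/-- Fubini for the window: a count over `{0,1}^{L+H+M}` is the iterated count over `h`, `x`,
`z`. -/
private theorem card_filter_window_eq_sum (Q : (Fin (L + H + M) → Bool) → Prop) [DecidablePred Q] :
    (univ.filter fun v : Fin (L + H + M) → Bool => Q v).card =
      ∑ h : Fin H → Bool, ∑ x : Fin L → Bool,
        (univ.filter fun z : Fin M → Bool => Q (glue3 x h z)).card := by
  rw [card_filter_eq_sum_glue3]
  have hx : ∀ x : Fin L → Bool, ∑ z : Fin M → Bool,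
      (univ.filter fun h : Fin H → Bool => Q (glue3 x h z)).card =
      ∑ h : Fin H → Bool, (univ.filter fun z : Fin M → Bool => Q (glue3 x h z)).card := by
    intro x
    simp only [Finset.card_filter]
    rw [Finset.sum_comm]
  rw [Finset.sum_congr rfl fun x _ => hx x, Finset.sum_comm]

/-- **`TwoBlindSpotsSqrt` holds** (the density-`1/4` route: `oneSidedFibre`, `threeOffsetLemma`,
`four_mul_card_class_ge_two`, elimination hardness at degree `c₀√M`).
[cite: Srinivasan2023, Lemma 3.1] -/
theorem twoBlindSpotsSqrt : TwoBlindSpotsSqrt := by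
  classical
  obtain ⟨η₀, hη₀, c₀, hc₀, ℓ₀, H⟩ := elimSqrtDec_of_lowDegAvoidMod3Sparse lowDegAvoidMod3Sparse
  refine ⟨1 - η₀ / 4, by linarith, c₀, hc₀, ℓ₀, ?_⟩
  intro p L Hm M q hL hM D hD c y hdeg hZ
  -- elimination hardness on the block
  have hdF : η₀ * (2 : ℝ) ^ M ≤ (distFail D (fun _ : Fin M → Bool => false) : ℝ) :=
    le_distFail_zero_of fun a b ha hb dec => H M hM D hD a b ha hb dec
  -- the density of the three offsets `2|x| mod 3`
  have hdens : ∀ r : ℕ, 2 ^ L ≤ 4 * (univ.filter fun x : Fin L → Bool => 2 * wt x % 3 = r % 3).card := by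
    intro r
    have h := four_mul_card_class_ge_two hL (2 * r)
    have hset : (univ.filter fun x : Fin L → Bool => wt x % 3 = 2 * r % 3) =
        univ.filter fun x : Fin L → Bool => 2 * wt x % 3 = r % 3 :=
      Finset.filter_congr fun x _ => by omega
    rwa [hset] at h
  -- loss count on each fibre `(a, h, b)`
  have hfib : ∀ (a : Fin p → Bool) (h : Fin Hm → Bool) (b : Fin q → Bool),
      2 ^ L * distFail D (fun _ : Fin M → Bool => false) ≤
        4 * ∑ x : Fin L → Bool, (univ.filter fun z : Fin M → Bool =>
          ringWinU c y (glue3 a (glue3 x h z) b) = false).card := by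
    intro a h b
    obtain ⟨B, hper, heven, hxe⟩ := oneSidedFibre p L Hm M q D c y hdeg hZ a h b
    choose e he hident using hxe
    have h3 := threeOffsetLemma L M D B hper heven (fun x => 2 * wt x) hdens e he
    have hpair : (univ.filter fun xz : (Fin L → Bool) × (Fin M → Bool) =>
        xor (e xz.1 xz.2) (B (2 * wt xz.1) xz.2) = false).card =
        ∑ x : Fin L → Bool, (univ.filter fun z : Fin M → Bool =>
          ringWinU c y (glue3 a (glue3 x h z) b) = false).card := by
      rw [Finset.card_filter, ← Finset.univ_product_univ, Finset.sum_product]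
      refine Finset.sum_congr rfl fun x _ => ?_
      rw [Finset.card_filter]
      refine Finset.sum_congr rfl fun z _ => ?_
      rw [hident x z]
    rw [hpair] at h3
    exact h3
  -- total loss
  have hLsum : (univ.filter fun u : Fin (p + (L + Hm + M) + q) → Bool => ringWinU c y u = false).card =
      ∑ a : Fin p → Bool, ∑ b : Fin q → Bool, ∑ h : Fin Hm → Bool,
        ∑ x : Fin L → Bool, (univ.filter fun z : Fin M → Bool =>
          ringWinU c y (glue3 a (glue3 x h z) b) = false).card := by
    rw [card_filter_eq_sum_glue3]
    refine Finset.sum_congr rfl fun a _ => Finset.sum_congr rfl fun b _ => ?_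
    exact card_filter_window_eq_sum (fun v => ringWinU c y (glue3 a v b) = false)
  have h4 : 2 ^ p * (2 ^ q * (2 ^ Hm * (2 ^ L * distFail D (fun _ : Fin M → Bool => false)))) ≤
      4 * (univ.filter fun u : Fin (p + (L + Hm + M) + q) → Bool => ringWinU c y u = false).card := by
    rw [hLsum, Finset.mul_sum]
    have hconst : ∀ (α : Type) [Fintype α] (t : ℕ), ∑ _i : α, t = Fintype.card α * t := by
      intro α _ t
      rw [Finset.sum_const, Finset.card_univ, smul_eq_mul]
    have hp : Fintype.card (Fin p → Bool) = 2 ^ p := by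
      rw [Fintype.card_fun, Fintype.card_bool, Fintype.card_fin]
    have hq : Fintype.card (Fin q → Bool) = 2 ^ q := by
      rw [Fintype.card_fun, Fintype.card_bool, Fintype.card_fin]
    have hH : Fintype.card (Fin Hm → Bool) = 2 ^ Hm := by
      rw [Fintype.card_fun, Fintype.card_bool, Fintype.card_fin]
    rw [← hp, ← hconst]
    refine Finset.sum_le_sum fun a _ => ?_
    rw [Finset.mul_sum, ← hq, ← hconst]
    refine Finset.sum_le_sum fun b _ => ?_
    rw [Finset.mul_sum, ← hH, ← hconst]
    exact Finset.sum_le_sum fun h _ => hfib a h b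
  -- wins and losses
  have htot : (univ.filter fun u : Fin (p + (L + Hm + M) + q) → Bool => ringWinU c y u = true).card +
      (univ.filter fun u : Fin (p + (L + Hm + M) + q) → Bool => ringWinU c y u = false).card =
      2 ^ (p + (L + Hm + M) + q) := by
    have h := Finset.card_filter_add_card_filter_not
      (s := (univ : Finset (Fin (p + (L + Hm + M) + q) → Bool))) (fun u => ringWinU c y u = true)
    have hneg : (univ.filter fun u : Fin (p + (L + Hm + M) + q) → Bool => ¬ ringWinU c y u = true) =
        univ.filter fun u : Fin (p + (L + Hm + M) + q) → Bool => ringWinU c y u = false :=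
      Finset.filter_congr fun u _ => by simp
    rw [hneg, Finset.card_univ, Fintype.card_fun, Fintype.card_bool, Fintype.card_fin] at h
    exact h
  have htotR : ((univ.filter fun u : Fin (p + (L + Hm + M) + q) → Bool => ringWinU c y u = true).card : ℝ)
      + ((univ.filter fun u : Fin (p + (L + Hm + M) + q) → Bool => ringWinU c y u = false).card : ℝ) =
      (2 : ℝ) ^ (p + (L + Hm + M) + q) := by exact_mod_cast htot
  have h4R : (2 : ℝ) ^ p * ((2 : ℝ) ^ q * ((2 : ℝ) ^ Hm * ((2 : ℝ) ^ L *
      (distFail D (fun _ : Fin M → Bool => false) : ℝ)))) ≤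
      4 * ((univ.filter fun u : Fin (p + (L + Hm + M) + q) → Bool => ringWinU c y u = false).card : ℝ) := by
    exact_mod_cast h4
  have hpow : (2 : ℝ) ^ (p + (L + Hm + M) + q) =
      (2 : ℝ) ^ p * ((2 : ℝ) ^ q * ((2 : ℝ) ^ Hm * ((2 : ℝ) ^ L * (2 : ℝ) ^ M))) := by
    rw [← pow_add, ← pow_add, ← pow_add, ← pow_add]; congr 1; omega
  have key : η₀ * (2 : ℝ) ^ (p + (L + Hm + M) + q) ≤
      4 * ((univ.filter fun u : Fin (p + (L + Hm + M) + q) → Bool => ringWinU c y u = false).card : ℝ) := by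
    calc η₀ * (2 : ℝ) ^ (p + (L + Hm + M) + q)
        = (2 : ℝ) ^ p * ((2 : ℝ) ^ q * ((2 : ℝ) ^ Hm * ((2 : ℝ) ^ L * (η₀ * (2 : ℝ) ^ M)))) := by
          rw [hpow]; ring
      _ ≤ (2 : ℝ) ^ p * ((2 : ℝ) ^ q * ((2 : ℝ) ^ Hm * ((2 : ℝ) ^ L *
          (distFail D (fun _ : Fin M → Bool => false) : ℝ)))) := by
          gcongr
      _ ≤ _ := h4R
  linarith

end Summit.QuantumAdvantage.AdviceFreeQNC0
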